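import Summits.AtomisticToContinuum.BoseEinsteinCondensation.Theorems.BECThomsonPrincipleGDTransferBareSecondVariationCommutators

/-!
# Route `BECThomsonPrinciple`, crux `GDTransfer` (stmt-AtomisticToContinuum-9482), line `dyson-dressed-witness`:
# stub `bareSecondVariation`, part 3 — the exact kinetic form identity of the LNSS pair

Support file of `stub_bareSecondVariation`, continuing parts 1–2.  With the polar kinetic form
`t(f, g) = ∫_{cell^N} Σ_{j,a} conj(∂_{j,a}f) ∂_{j,a}g` (written out; its diagonal is `∫|∇f|²`), for periodic `C¹`
`f, g` and every `n ∈ ℤ³`: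
`t(f, Λ_n† g) − t(Λ_n f, g) = |k|² ∫ conj(f) Λ_n† g`, `|k|² = (2π/L)² Σ_a n_a²`
(`tform_lnssUpper_sub_tform_lnssLower`) — the form version of `[−Δ, Λ_n†] = |k|² Λ_n† + (terms killed by
adjointness)`, i.e. the KINETIC part of the Kennedy–Lieb–Shastry double commutator for the LNSS pair is exactly
`|k|²(‖Λ_n†Ψ‖² − ‖Λ_nΨ‖²)`.  Proof: slot by slot, the pieces `⟨∂f, Λ_n†∂g⟩` and `⟨Λ_n∂f, ∂g⟩` cancel by
adjointness (part 1); the slot-`j` piece `G_j = e_n(x_j)P_jRg` of `Λ_n†g` is an eigenfunction of `∂_{j,a}`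
(`∂_{j,a}G_j = (2πi n_a/L)G_j`, `P_jRg` being flat in slot `j`) and one periodic integration by parts
(`integral_cellN_mul_fderiv_apply`) gives `∫ conj(∂_{j,a}f) G_j = −(2πi n_a/L)⟨f, G_j⟩`; the flat piece
`R P_j^{(n)} f` of `∂_{j,a}(Λ_n f)` integrates to zero against `∂_{j,a} g` by the same integration by parts.
All [folklore] (KennedyLiebShastry1988 (12)–(14); arXiv:1211.2778 §2–3).
-/

noncomputable section

open MeasureTheory Filter
open scoped ENNReal NNReal ComplexConjugate

namespace Summit.AtomisticToContinuum.BoseEinsteinCondensation.Cruxes.GDTransfer.DysonDressedWitness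

namespace SecondVariation

open Literature.MathematicalPhysics.QuantumManyBody.BoseGas
open Summit.AtomisticToContinuum.BoseEinsteinCondensation.Theorems.GaussianDominationCan.Negative
open ChordVariation (continuous_modeProj)
open Lnss

variable {N m : ℕ} {L : ℝ}

/-! ## The exact identity `t(f, Λ_n†g) − t(Λ_nf, g) = |k|² ⟨f, Λ_n†g⟩` -/

/-- The slot-`j` piece `G_j = e_n(x_j) P_j n̂₀^{-1/2} g` of `Λ_n† g` is `C¹` for `C¹` `g`. [folklore] -/
theorem contDiff_slotUpper (n : Fin 3 → ℤ) (j : Fin (m + 1)) {g : Config (m + 1) → ℂ}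
    (hg : ContDiff ℝ 1 g) :
    ContDiff ℝ 1 fun X : Config (m + 1) => cellWave L n (X j) * cellAvg (m + 1) L j (rootInv m L g) X :=
  (contDiff_cellWave_comp_apply (n := 1) L n j).mul (contDiff_cellAvg j (contDiff_rootInv hg))

/-- `G_j` is periodic for periodic `g` (`L ≠ 0`). [folklore] -/
theorem slotUpper_periodic (hL : L ≠ 0) (n : Fin 3 → ℤ) (j : Fin (m + 1)) {g : Config (m + 1) → ℂ}
    (hgp : ∀ (X : Config (m + 1)) (i : Fin (m + 1)) (k : Fin 3),
      g (X + Pi.single i (EuclideanSpace.single k L)) = g X)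
    (X : Config (m + 1)) (i : Fin (m + 1)) (k : Fin 3) :
    cellWave L n ((X + Pi.single i (EuclideanSpace.single k L) : Config (m + 1)) j) *
        cellAvg (m + 1) L j (rootInv m L g) (X + Pi.single i (EuclideanSpace.single k L)) =
      cellWave L n (X j) * cellAvg (m + 1) L j (rootInv m L g) X := by
  rw [cellAvg_periodic j (rootInv_periodic hgp) X i k, Pi.add_apply]
  rcases eq_or_ne i j with rfl | hij
  · rw [Pi.single_eq_same, cellWave_periodic hL]
  · rw [Pi.single_eq_of_ne' hij, add_zero]

/-- `G_j` is an eigenfunction of `∂_{j,a}`: `∂_{j,a} G_j = (2πi n_a/L) G_j` (`P_j n̂₀^{-1/2} g` is flat in slot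
`j`). [folklore] -/
theorem fderiv_slotUpper_self (n : Fin 3 → ℤ) (j : Fin (m + 1)) (a : Fin 3) {g : Config (m + 1) → ℂ}
    (hg : ContDiff ℝ 1 g) (X : Config (m + 1)) :
    fderiv ℝ (fun Y : Config (m + 1) => cellWave L n (Y j) * cellAvg (m + 1) L j (rootInv m L g) Y) X
        (Pi.single j (EuclideanSpace.single a 1)) =
      (2 * Real.pi * Complex.I * (n a) / L) *
        (cellWave L n (X j) * cellAvg (m + 1) L j (rootInv m L g) X) := by
  have hR : ContDiff ℝ 1 (rootInv m L g) := contDiff_rootInv hg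
  rw [fderiv_mul_apply (differentiable_cellWave_comp_apply L n j X)
      ((contDiff_cellAvg j hR).differentiable one_ne_zero X),
    fderiv_cellWave_comp_apply_single_single L n j j a X rfl, if_pos rfl, waveCoeff_eq,
    fderiv_cellAvg_single_self j hR X]
  ring

/-- **First integration by parts**: `∫ conj(∂_{j,a} f) G_j = −(2πi n_a/L) ∫ conj(f) G_j`. [folklore] -/
theorem integral_conj_fderiv_mul_slotUpper (hL : 0 < L) (n : Fin 3 → ℤ) (j : Fin (m + 1)) (a : Fin 3)
    {f g : Config (m + 1) → ℂ} (hf : ContDiff ℝ 1 f)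
    (hfp : ∀ (X : Config (m + 1)) (i : Fin (m + 1)) (k : Fin 3),
      f (X + Pi.single i (EuclideanSpace.single k L)) = f X)
    (hg : ContDiff ℝ 1 g)
    (hgp : ∀ (X : Config (m + 1)) (i : Fin (m + 1)) (k : Fin 3),
      g (X + Pi.single i (EuclideanSpace.single k L)) = g X) :
    ∫ X in cellN (m + 1) L, conj (fderiv ℝ f X (Pi.single j (EuclideanSpace.single a 1))) *
        (cellWave L n (X j) * cellAvg (m + 1) L j (rootInv m L g) X) =
      -(2 * Real.pi * Complex.I * (n a) / L) *
        ∫ X in cellN (m + 1) L, conj (f X) * (cellWave L n (X j) * cellAvg (m + 1) L j (rootInv m L g) X) := by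
  have hGd := contDiff_slotUpper (L := L) n j hg
  have hGp := slotUpper_periodic hL.ne' n j hgp
  have hcf : ContDiff ℝ 1 fun X => conj (f X) := Complex.conjCLE.contDiff.comp hf
  have hcfp : ∀ (X : Config (m + 1)) (i : Fin (m + 1)) (k : Fin 3),
      conj (f (X + Pi.single i (EuclideanSpace.single k L))) = conj (f X) := fun X i k => by
    rw [hfp X i k]
  have hbp := integral_cellN_mul_fderiv_apply hL hGd hcf hGp hcfp
    (Pi.single j (EuclideanSpace.single a 1))
  calc ∫ X in cellN (m + 1) L, conj (fderiv ℝ f X (Pi.single j (EuclideanSpace.single a 1))) *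
        (cellWave L n (X j) * cellAvg (m + 1) L j (rootInv m L g) X)
      = ∫ X in cellN (m + 1) L, (cellWave L n (X j) * cellAvg (m + 1) L j (rootInv m L g) X) *
          fderiv ℝ (fun Y => conj (f Y)) X (Pi.single j (EuclideanSpace.single a 1)) := by
        refine integral_congr_ae (Eventually.of_forall fun X => ?_)
        simp only
        rw [fderiv_conj_apply (hf.differentiable one_ne_zero X), mul_comm]
    _ = -∫ X in cellN (m + 1) L, fderiv ℝ (fun Y : Config (m + 1) =>
          cellWave L n (Y j) * cellAvg (m + 1) L j (rootInv m L g) Y) X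
            (Pi.single j (EuclideanSpace.single a 1)) * conj (f X) := hbp
    _ = -∫ X in cellN (m + 1) L, (2 * Real.pi * Complex.I * (n a) / L) *
          (conj (f X) * (cellWave L n (X j) * cellAvg (m + 1) L j (rootInv m L g) X)) := by
        congr 1
        refine integral_congr_ae (Eventually.of_forall fun X => ?_)
        simp only
        rw [fderiv_slotUpper_self n j a hg X]
        ring
    _ = -(2 * Real.pi * Complex.I * (n a) / L) *
        ∫ X in cellN (m + 1) L, conj (f X) *
          (cellWave L n (X j) * cellAvg (m + 1) L j (rootInv m L g) X) := by
        rw [integral_const_mul, neg_mul]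

/-- **Second integration by parts**: `∫ conj(n̂₀^{-1/2} P_j^{(n)} f) ∂_{j,a} g = 0` (`n̂₀^{-1/2} P_j^{(n)} f` is
flat in slot `j`). [folklore] -/
theorem integral_conj_rootInv_fourierAvg_mul_fderiv (hL : 0 < L) (n : Fin 3 → ℤ) (j : Fin (m + 1))
    (a : Fin 3) {f g : Config (m + 1) → ℂ} (hf : ContDiff ℝ 1 f)
    (hfp : ∀ (X : Config (m + 1)) (i : Fin (m + 1)) (k : Fin 3),
      f (X + Pi.single i (EuclideanSpace.single k L)) = f X)
    (hg : ContDiff ℝ 1 g)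
    (hgp : ∀ (X : Config (m + 1)) (i : Fin (m + 1)) (k : Fin 3),
      g (X + Pi.single i (EuclideanSpace.single k L)) = g X) :
    ∫ X in cellN (m + 1) L, conj (rootInv m L (fourierAvg m L n j f) X) *
        fderiv ℝ g X (Pi.single j (EuclideanSpace.single a 1)) = 0 := by
  have hPd : ContDiff ℝ 1 (fourierAvg m L n j f) := contDiff_fourierAvg n j hf
  have hPp := fourierAvg_periodic (L := L) n j hfp
  have hFd : ContDiff ℝ 1 (rootInv m L (fourierAvg m L n j f)) := contDiff_rootInv hPd
  have hFp := rootInv_periodic (L := L) hPp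
  have hFder : ∀ X, fderiv ℝ (rootInv m L (fourierAvg m L n j f)) X
      (Pi.single j (EuclideanSpace.single a 1)) = 0 := by
    intro X
    rw [congrFun (fderiv_rootInv_single hL j a hPd hPp) X]
    have hz : (fun Y => fderiv ℝ (fourierAvg m L n j f) Y (Pi.single j (EuclideanSpace.single a 1))) =
        fun _ => 0 := funext fun Y => fderiv_fourierAvg_single_self n j hf Y _
    rw [hz, rootInv_zero]
  have hcF : ContDiff ℝ 1 fun X => conj (rootInv m L (fourierAvg m L n j f) X) :=
    Complex.conjCLE.contDiff.comp hFd
  have hcFp : ∀ (X : Config (m + 1)) (i : Fin (m + 1)) (k : Fin 3),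
      conj (rootInv m L (fourierAvg m L n j f) (X + Pi.single i (EuclideanSpace.single k L))) =
        conj (rootInv m L (fourierAvg m L n j f) X) := fun X i k => by rw [hFp X i k]
  rw [integral_cellN_mul_fderiv_apply hL hcF hg hcFp hgp (Pi.single j (EuclideanSpace.single a 1))]
  have h0 : ∀ X, fderiv ℝ (fun Y => conj (rootInv m L (fourierAvg m L n j f) Y)) X
      (Pi.single j (EuclideanSpace.single a 1)) * g X = 0 := by
    intro X
    rw [fderiv_conj_apply (hFd.differentiable one_ne_zero X), hFder X, map_zero, zero_mul]
  simp_rw [h0]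
  rw [integral_zero, neg_zero]

/-- **Slot `(j,a)` of `t(f, Λ_n† g)`**:
`∫ conj(∂_{j,a}f) ∂_{j,a}(Λ_n†g) = (2πn_a/L)² ∫ conj(f) G_j + ∫ conj(Λ_n ∂_{j,a}f) ∂_{j,a}g`. [folklore] -/
theorem tform_slot_lnssUpper (hL : 0 < L) (n : Fin 3 → ℤ) (j : Fin (m + 1)) (a : Fin 3)
    {f g : Config (m + 1) → ℂ} (hf : ContDiff ℝ 1 f)
    (hfp : ∀ (X : Config (m + 1)) (i : Fin (m + 1)) (k : Fin 3),
      f (X + Pi.single i (EuclideanSpace.single k L)) = f X)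
    (hg : ContDiff ℝ 1 g)
    (hgp : ∀ (X : Config (m + 1)) (i : Fin (m + 1)) (k : Fin 3),
      g (X + Pi.single i (EuclideanSpace.single k L)) = g X) :
    ∫ X in cellN (m + 1) L, conj (fderiv ℝ f X (Pi.single j (EuclideanSpace.single a 1))) *
        fderiv ℝ (lnssUpper m L n g) X (Pi.single j (EuclideanSpace.single a 1)) =
      -(2 * Real.pi * Complex.I * (n a) / L) ^ 2 *
          (∫ X in cellN (m + 1) L, conj (f X) *
            (cellWave L n (X j) * cellAvg (m + 1) L j (rootInv m L g) X)) +
        ∫ X in cellN (m + 1) L,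
          conj (lnssLower m L n (fun Y => fderiv ℝ f Y (Pi.single j (EuclideanSpace.single a 1))) X) *
            fderiv ℝ g X (Pi.single j (EuclideanSpace.single a 1)) := by
  have hf' : Continuous fun Y => fderiv ℝ f Y (Pi.single j (EuclideanSpace.single a 1)) :=
    continuous_fderiv_apply_const hf _
  have hg' : Continuous fun Y => fderiv ℝ g Y (Pi.single j (EuclideanSpace.single a 1)) :=
    continuous_fderiv_apply_const hg _
  have hcf' : Continuous fun Y => conj (fderiv ℝ f Y (Pi.single j (EuclideanSpace.single a 1))) :=
    Complex.continuous_conj.comp hf'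
  have hGc : Continuous fun X : Config (m + 1) =>
      cellWave L n (X j) * cellAvg (m + 1) L j (rootInv m L g) X := (contDiff_slotUpper n j hg).continuous
  have hUc : Continuous (lnssUpper m L n fun Y => fderiv ℝ g Y (Pi.single j (EuclideanSpace.single a 1))) :=
    continuous_lnssUpper n hg'
  have h1 : IntegrableOn (fun X => (2 * Real.pi * Complex.I * (n a) / L) *
      (conj (fderiv ℝ f X (Pi.single j (EuclideanSpace.single a 1))) *
        (cellWave L n (X j) * cellAvg (m + 1) L j (rootInv m L g) X))) (cellN (m + 1) L) volume :=
    integrableOn_cellN (continuous_const.mul (hcf'.mul hGc)) L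
  have h2 : IntegrableOn (fun X => conj (fderiv ℝ f X (Pi.single j (EuclideanSpace.single a 1))) *
      lnssUpper m L n (fun Y => fderiv ℝ g Y (Pi.single j (EuclideanSpace.single a 1))) X)
      (cellN (m + 1) L) volume := integrableOn_cellN (hcf'.mul hUc) L
  calc ∫ X in cellN (m + 1) L, conj (fderiv ℝ f X (Pi.single j (EuclideanSpace.single a 1))) *
        fderiv ℝ (lnssUpper m L n g) X (Pi.single j (EuclideanSpace.single a 1))
      = ∫ X in cellN (m + 1) L, (2 * Real.pi * Complex.I * (n a) / L) *
          (conj (fderiv ℝ f X (Pi.single j (EuclideanSpace.single a 1))) *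
            (cellWave L n (X j) * cellAvg (m + 1) L j (rootInv m L g) X)) +
          conj (fderiv ℝ f X (Pi.single j (EuclideanSpace.single a 1))) *
            lnssUpper m L n (fun Y => fderiv ℝ g Y (Pi.single j (EuclideanSpace.single a 1))) X := by
        refine integral_congr_ae (Eventually.of_forall fun X => ?_)
        simp only
        rw [fderiv_lnssUpper_single hL n j a hg hgp X]
        ring
    _ = (2 * Real.pi * Complex.I * (n a) / L) *
          (∫ X in cellN (m + 1) L, conj (fderiv ℝ f X (Pi.single j (EuclideanSpace.single a 1))) *
            (cellWave L n (X j) * cellAvg (m + 1) L j (rootInv m L g) X)) +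
          ∫ X in cellN (m + 1) L, conj (fderiv ℝ f X (Pi.single j (EuclideanSpace.single a 1))) *
            lnssUpper m L n (fun Y => fderiv ℝ g Y (Pi.single j (EuclideanSpace.single a 1))) X := by
        rw [integral_add h1 h2, integral_const_mul]
    _ = -(2 * Real.pi * Complex.I * (n a) / L) ^ 2 *
          (∫ X in cellN (m + 1) L, conj (f X) *
            (cellWave L n (X j) * cellAvg (m + 1) L j (rootInv m L g) X)) +
        ∫ X in cellN (m + 1) L,
          conj (lnssLower m L n (fun Y => fderiv ℝ f Y (Pi.single j (EuclideanSpace.single a 1))) X) *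
            fderiv ℝ g X (Pi.single j (EuclideanSpace.single a 1)) := by
        rw [integral_conj_fderiv_mul_slotUpper hL n j a hf hfp hg hgp,
          integral_conj_mul_lnssUpper n hf' hg']
        ring

/-- **Slot `(j,a)` of `t(Λ_n f, g)`**: `∫ conj(∂_{j,a}(Λ_n f)) ∂_{j,a}g = ∫ conj(Λ_n ∂_{j,a}f) ∂_{j,a}g` (the flat
piece integrates to zero against `∂_{j,a} g`). [folklore] -/
theorem tform_slot_lnssLower (hL : 0 < L) (n : Fin 3 → ℤ) (j : Fin (m + 1)) (a : Fin 3)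
    {f g : Config (m + 1) → ℂ} (hf : ContDiff ℝ 1 f)
    (hfp : ∀ (X : Config (m + 1)) (i : Fin (m + 1)) (k : Fin 3),
      f (X + Pi.single i (EuclideanSpace.single k L)) = f X)
    (hg : ContDiff ℝ 1 g)
    (hgp : ∀ (X : Config (m + 1)) (i : Fin (m + 1)) (k : Fin 3),
      g (X + Pi.single i (EuclideanSpace.single k L)) = g X) :
    ∫ X in cellN (m + 1) L,
        conj (fderiv ℝ (lnssLower m L n f) X (Pi.single j (EuclideanSpace.single a 1))) *
          fderiv ℝ g X (Pi.single j (EuclideanSpace.single a 1)) =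
      ∫ X in cellN (m + 1) L,
        conj (lnssLower m L n (fun Y => fderiv ℝ f Y (Pi.single j (EuclideanSpace.single a 1))) X) *
          fderiv ℝ g X (Pi.single j (EuclideanSpace.single a 1)) := by
  have hf' : Continuous fun Y => fderiv ℝ f Y (Pi.single j (EuclideanSpace.single a 1)) :=
    continuous_fderiv_apply_const hf _
  have hg' : Continuous fun Y => fderiv ℝ g Y (Pi.single j (EuclideanSpace.single a 1)) :=
    continuous_fderiv_apply_const hg _
  have hLc : Continuous (lnssLower m L n fun Y => fderiv ℝ f Y (Pi.single j (EuclideanSpace.single a 1))) :=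
    continuous_lnssLower n hf'
  have hRc : Continuous (rootInv m L (fourierAvg m L n j f)) :=
    continuous_rootInv (continuous_fourierAvg n j hf.continuous)
  have h1 : IntegrableOn (fun X =>
      conj (lnssLower m L n (fun Y => fderiv ℝ f Y (Pi.single j (EuclideanSpace.single a 1))) X) *
        fderiv ℝ g X (Pi.single j (EuclideanSpace.single a 1))) (cellN (m + 1) L) volume :=
    integrableOn_cellN ((Complex.continuous_conj.comp hLc).mul hg') L
  have h2 : IntegrableOn (fun X => conj (2 * Real.pi * Complex.I * (n a) / L) *
      (conj (rootInv m L (fourierAvg m L n j f) X) *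
        fderiv ℝ g X (Pi.single j (EuclideanSpace.single a 1)))) (cellN (m + 1) L) volume :=
    integrableOn_cellN (continuous_const.mul ((Complex.continuous_conj.comp hRc).mul hg')) L
  calc ∫ X in cellN (m + 1) L,
        conj (fderiv ℝ (lnssLower m L n f) X (Pi.single j (EuclideanSpace.single a 1))) *
          fderiv ℝ g X (Pi.single j (EuclideanSpace.single a 1))
      = ∫ X in cellN (m + 1) L,
          conj (lnssLower m L n (fun Y => fderiv ℝ f Y (Pi.single j (EuclideanSpace.single a 1))) X) *
              fderiv ℝ g X (Pi.single j (EuclideanSpace.single a 1)) -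
            conj (2 * Real.pi * Complex.I * (n a) / L) *
              (conj (rootInv m L (fourierAvg m L n j f) X) *
                fderiv ℝ g X (Pi.single j (EuclideanSpace.single a 1))) := by
        refine integral_congr_ae (Eventually.of_forall fun X => ?_)
        simp only
        rw [fderiv_lnssLower_single hL n j a hf hfp X, map_sub, map_mul]
        ring
    _ = ∫ X in cellN (m + 1) L,
          conj (lnssLower m L n (fun Y => fderiv ℝ f Y (Pi.single j (EuclideanSpace.single a 1))) X) *
            fderiv ℝ g X (Pi.single j (EuclideanSpace.single a 1)) := by
        rw [integral_sub h1 h2, integral_const_mul,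
          integral_conj_rootInv_fourierAvg_mul_fderiv hL n j a hf hfp hg hgp, mul_zero, sub_zero]

/-- `Σ_a (2πi n_a/L)² = −(2π/L)² Σ_a n_a²` as a complex number. [folklore] -/
theorem sum_waveCoeff_sq (L : ℝ) (n : Fin 3 → ℤ) :
    ∑ a : Fin 3, -(2 * Real.pi * Complex.I * (n a) / L) ^ 2 =
      ((((2 * Real.pi / L) ^ 2 * ∑ a : Fin 3, ((n a : ℝ)) ^ 2 : ℝ)) : ℂ) := by
  push_cast
  rw [Finset.mul_sum]
  refine Finset.sum_congr rfl fun a _ => ?_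
  have hI : Complex.I ^ 2 = -1 := Complex.I_sq
  linear_combination -((2 * Real.pi * (n a : ℂ) / L) ^ 2) * hI

/-- **The exact kinetic form identity of the LNSS pair** (form-level `[−Δ, Λ_n†] = |k|²Λ_n† + …`): for
periodic `C¹` `f, g` and `k = 2πn/L`,
`t(f, Λ_n† g) − t(Λ_n f, g) = |k|² ⟨f, Λ_n† g⟩`, `|k|² = (2π/L)² Σ_a n_a²`. [folklore]
(KennedyLiebShastry1988 (12)–(14); arXiv:1211.2778 §2) -/
theorem tform_lnssUpper_sub_tform_lnssLower (hL : 0 < L) (n : Fin 3 → ℤ)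
    {f g : Config (m + 1) → ℂ} (hf : ContDiff ℝ 1 f)
    (hfp : ∀ (X : Config (m + 1)) (i : Fin (m + 1)) (k : Fin 3),
      f (X + Pi.single i (EuclideanSpace.single k L)) = f X)
    (hg : ContDiff ℝ 1 g)
    (hgp : ∀ (X : Config (m + 1)) (i : Fin (m + 1)) (k : Fin 3),
      g (X + Pi.single i (EuclideanSpace.single k L)) = g X) :
    (∫ X in cellN (m + 1) L, ∑ j : Fin (m + 1), ∑ a : Fin 3,
        conj (fderiv ℝ f X (Pi.single j (EuclideanSpace.single a 1))) *
          fderiv ℝ (lnssUpper m L n g) X (Pi.single j (EuclideanSpace.single a 1))) -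
      (∫ X in cellN (m + 1) L, ∑ j : Fin (m + 1), ∑ a : Fin 3,
        conj (fderiv ℝ (lnssLower m L n f) X (Pi.single j (EuclideanSpace.single a 1))) *
          fderiv ℝ g X (Pi.single j (EuclideanSpace.single a 1))) =
      ((((2 * Real.pi / L) ^ 2 * ∑ a : Fin 3, ((n a : ℝ)) ^ 2 : ℝ)) : ℂ) *
        ∫ X in cellN (m + 1) L, conj (f X) * lnssUpper m L n g X := by
  -- continuity of all integrands
  have hUd : ContDiff ℝ 1 (lnssUpper m L n g) := contDiff_lnssUpper n hg
  have hLd : ContDiff ℝ 1 (lnssLower m L n f) := contDiff_lnssLower n hf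
  have hT1 : ∀ (j : Fin (m + 1)) (a : Fin 3), Continuous fun X =>
      conj (fderiv ℝ f X (Pi.single j (EuclideanSpace.single a 1))) *
        fderiv ℝ (lnssUpper m L n g) X (Pi.single j (EuclideanSpace.single a 1)) := fun j a =>
    (Complex.continuous_conj.comp (continuous_fderiv_apply_const hf _)).mul
      (continuous_fderiv_apply_const hUd _)
  have hT2 : ∀ (j : Fin (m + 1)) (a : Fin 3), Continuous fun X =>
      conj (fderiv ℝ (lnssLower m L n f) X (Pi.single j (EuclideanSpace.single a 1))) *
        fderiv ℝ g X (Pi.single j (EuclideanSpace.single a 1)) := fun j a =>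
    (Complex.continuous_conj.comp (continuous_fderiv_apply_const hLd _)).mul
      (continuous_fderiv_apply_const hg _)
  -- `∫ Σ Σ = Σ Σ ∫`
  have e1 : (∫ X in cellN (m + 1) L, ∑ j : Fin (m + 1), ∑ a : Fin 3,
      conj (fderiv ℝ f X (Pi.single j (EuclideanSpace.single a 1))) *
        fderiv ℝ (lnssUpper m L n g) X (Pi.single j (EuclideanSpace.single a 1))) =
      ∑ j : Fin (m + 1), ∑ a : Fin 3,
      ∫ X in cellN (m + 1) L, conj (fderiv ℝ f X (Pi.single j (EuclideanSpace.single a 1))) *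
        fderiv ℝ (lnssUpper m L n g) X (Pi.single j (EuclideanSpace.single a 1)) := by
    rw [integral_finsetSum _ fun j _ => integrable_finsetSum _ fun a _ =>
      integrableOn_cellN (hT1 j a) L]
    exact Finset.sum_congr rfl fun j _ =>
      integral_finsetSum _ fun a _ => integrableOn_cellN (hT1 j a) L
  have e2 : (∫ X in cellN (m + 1) L, ∑ j : Fin (m + 1), ∑ a : Fin 3,
      conj (fderiv ℝ (lnssLower m L n f) X (Pi.single j (EuclideanSpace.single a 1))) *
        fderiv ℝ g X (Pi.single j (EuclideanSpace.single a 1))) =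
      ∑ j : Fin (m + 1), ∑ a : Fin 3,
      ∫ X in cellN (m + 1) L,
        conj (fderiv ℝ (lnssLower m L n f) X (Pi.single j (EuclideanSpace.single a 1))) *
          fderiv ℝ g X (Pi.single j (EuclideanSpace.single a 1)) := by
    rw [integral_finsetSum _ fun j _ => integrable_finsetSum _ fun a _ =>
      integrableOn_cellN (hT2 j a) L]
    exact Finset.sum_congr rfl fun j _ =>
      integral_finsetSum _ fun a _ => integrableOn_cellN (hT2 j a) L
  -- `Σ_j ⟨f, G_j⟩ = ⟨f, Λ_n† g⟩`
  have hRc : Continuous (rootInv m L g) := continuous_rootInv hg.continuous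
  have hint : ∀ j ∈ (Finset.univ : Finset (Fin (m + 1))), Integrable
      (fun X => conj (f X) * (cellWave L n (X j) * cellAvg (m + 1) L j (rootInv m L g) X))
      ((volume : Measure (Config (m + 1))).restrict (cellN (m + 1) L)) := fun j _ =>
    integrableOn_cellN ((Complex.continuous_conj.comp hf.continuous).mul
      (((continuous_cellWave L n).comp (continuous_apply j)).mul (continuous_cellAvg j hRc))) L
  have e3 : ∑ j : Fin (m + 1), ∫ X in cellN (m + 1) L, conj (f X) *
      (cellWave L n (X j) * cellAvg (m + 1) L j (rootInv m L g) X) =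
        ∫ X in cellN (m + 1) L, conj (f X) * lnssUpper m L n g X := by
    rw [← integral_finsetSum _ hint]
    refine integral_congr_ae (Eventually.of_forall fun X => ?_)
    simp only [lnssUpper, Finset.mul_sum]
  rw [e1, e2, ← Finset.sum_sub_distrib, ← e3, Finset.mul_sum]
  refine Finset.sum_congr rfl fun j _ => ?_
  rw [← Finset.sum_sub_distrib, ← sum_waveCoeff_sq, Finset.sum_mul]
  refine Finset.sum_congr rfl fun a _ => ?_
  rw [tform_slot_lnssUpper hL n j a hf hfp hg hgp, tform_slot_lnssLower hL n j a hf hfp hg hgp]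
  ring

end SecondVariation

open Literature.MathematicalPhysics.QuantumManyBody.BoseGas in
/-- **Part 3 of `stub_bareSecondVariation` (registered helper statement)**: the exact kinetic form identity of
the LNSS pair, `t(f, Λ_n† g) − t(Λ_n f, g) = (2π/L)² |n|² ∫ conj(f) Λ_n† g` for periodic `C¹` `f, g` (`L > 0`),
with `t(f, g) = ∫ Σ_{j,a} conj(∂_{j,a} f) ∂_{j,a} g`. [folklore] -/
theorem bareSecondVariation_kinetic_identity :
    ∀ (m : ℕ) (L : ℝ), 0 < L → ∀ (n : Fin 3 → ℤ)
      (f g : Literature.MathematicalPhysics.QuantumManyBody.BoseGas.Config (m + 1) → ℂ),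
      ContDiff ℝ 1 f →
      (∀ (X : Literature.MathematicalPhysics.QuantumManyBody.BoseGas.Config (m + 1)) (i : Fin (m + 1))
          (k : Fin 3), f (X + Pi.single i (EuclideanSpace.single k L)) = f X) →
      ContDiff ℝ 1 g →
      (∀ (X : Literature.MathematicalPhysics.QuantumManyBody.BoseGas.Config (m + 1)) (i : Fin (m + 1))
          (k : Fin 3), g (X + Pi.single i (EuclideanSpace.single k L)) = g X) →
        (∫ X in Literature.MathematicalPhysics.QuantumManyBody.BoseGas.cellN (m + 1) L,
            ∑ j : Fin (m + 1), ∑ a : Fin 3,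
              conj (fderiv ℝ f X (Pi.single j (EuclideanSpace.single a (1 : ℝ)))) *
                fderiv ℝ (lnssUpper m L n g) X (Pi.single j (EuclideanSpace.single a (1 : ℝ)))) -
          (∫ X in Literature.MathematicalPhysics.QuantumManyBody.BoseGas.cellN (m + 1) L,
            ∑ j : Fin (m + 1), ∑ a : Fin 3,
              conj (fderiv ℝ (lnssLower m L n f) X (Pi.single j (EuclideanSpace.single a (1 : ℝ)))) *
                fderiv ℝ g X (Pi.single j (EuclideanSpace.single a (1 : ℝ)))) =
        ((((2 * Real.pi / L) ^ 2 * ∑ a : Fin 3, ((n a : ℝ)) ^ 2 : ℝ)) : ℂ) *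
          ∫ X in Literature.MathematicalPhysics.QuantumManyBody.BoseGas.cellN (m + 1) L,
            conj (f X) * lnssUpper m L n g X :=
  fun _ _ hL n _ _ hf hfp hg hgp =>
    SecondVariation.tform_lnssUpper_sub_tform_lnssLower hL n hf hfp hg hgp

end Summit.AtomisticToContinuum.BoseEinsteinCondensation.Cruxes.GDTransfer.DysonDressedWitness

end
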